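import Literature.AlgebraicGeometry.Morphisms.FiniteEtaleGeometricFibreCard
import Literature.AlgebraicGeometry.Motives.AlgPoints
import HarnessLib

/-!
# A finite étale morphism of `k`-schemes has exactly `rank` geometric points over every geometric point — `AlgPoints` form
# ([GortzWedhorn2020] Prop. 12.21 with (12.6.1); [StacksProject] Tag 02GL)

Topic `Literature/AlgebraicGeometry/Motives`, namespace `Literature.AlgebraicGeometry.Motives.AlgPoints`.  THEOREMS only (no def, no
instance, no notation, no named fact, no `sorry`).  Cell `hodgecm-mathlib` (D-0151), FLOOR 0, programme F0P5a, crux item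
stmt-HodgeConjecture-24832 — row **(Γ3-D) `CardFibreEqFinrankOfFiniteEtale`** of the (γ3-GENERIC) desk `F0/P5a/Gamma3-DESK.v0.1.F0P5a-plan-g2.lean`
(F0P5a-plan (g2) 2026-08-31T01:32:49Z; A-p05 LEAD WORD #13): the TOTAL COUNT `n` of the two-section pushforward (Γ3-A).

Nothing new is proved about étale morphisms here: the count is ★ `Literature.AlgebraicGeometry.Morphisms.natCard_specOver_eq_finrank`
(`Morphisms/FiniteEtaleGeometricFibreCard.lean`: for `q : G ⟶ S` finite étale and `s : Spec Ω ⟶ S`, `Ω` separably closed,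
`Nat.card {x : Spec Ω ⟶ G // x ≫ q = s} = q.finrank (s ⋆)`).  This file is the TRANSPORT to the cell's `AlgPoints` ∕ `SchemeOver k` currency:

* `bijective_left_fibre` (+ `natCard_fibre_eq_natCard_specOver`) — for `p : T ⟶ X` over `k` and `x ∈ X(Ω)`, the `Ω`-points of `T` over `x`, `{y : AlgPoints T Ω // AlgPoints.map p y = x}`,
  ARE the morphisms of schemes `t : Spec Ω ⟶ T` with `t ≫ p = x` (an `Over`-morphism into `T` lying over `x` is its underlying morphism;
  conversely such a `t` is automatically a `k`-morphism because `x` is);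
* **`card_fibre_eq_finrank_of_isFinite_of_etale`** — for `p.left` finite étale and `Ω` separably closed:
  `Nat.card {y : AlgPoints T Ω // AlgPoints.map p y = x} = p.left.finrank (x.toSpecHom.base (closedPoint Ω))` — the desk statement (Γ3-D)
  verbatim (with `IsSepClosed` ⊇ `IsAlgClosed`), plus finiteness and the constancy over a preconnected `X`.

HC_CM is proved only modulo the 7 printed citations until rung 0 closes; this file is a generic leaf and changes no count.

## References
* [GortzWedhorn2020] U. Görtz, T. Wedhorn, *Algebraic Geometry I*, 2nd ed. (2020), Prop. 12.21, (12.6.1), Section (4.7) (4.7.1).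
* [StacksProject] The Stacks Project, Tag 02GL (étale morphisms: fibres), Tag 01JX (`Hom_S(T, X) = Hom_{S'}(T, X ×_S S')`).
-/

set_option autoImplicit false

noncomputable section

open CategoryTheory CategoryTheory.Limits AlgebraicGeometry

universe u

namespace Literature.AlgebraicGeometry.Motives

namespace AlgPoints

variable {k : Type u} [Field k] {Ω : Type u} [Field Ω] [Algebra k Ω] {X T : SchemeOver k} (p : T ⟶ X) (x : AlgPoints X Ω)

/-- The underlying morphism of an `Ω`-point of `T` over `x` lies over the underlying morphism of `x`.
[cite: GortzWedhorn2020, Section (4.7), (4.7.1) (p. 108)] -/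
theorem left_comp_left_of_map_eq {y : AlgPoints T Ω} (h : AlgPoints.map p y = x) : y.left ≫ p.left = x.left := by
  rw [← Over.comp_left, ← AlgPoints.map_apply, h]

/-- A morphism of schemes `t : Spec Ω ⟶ T` lying over the `k`-point `x` (i.e. `t ≫ p = x`) commutes with the structure maps to `Spec k`,
hence IS an `Ω`-point of the `k`-scheme `T`. [cite: GortzWedhorn2020, Section (4.7), (4.7.1) (p. 108)] -/
theorem comp_hom_eq_of_comp_left_eq {t : Spec (.of Ω) ⟶ T.left} (h : t ≫ p.left = x.left) :
    t ≫ T.hom = (specOver k Ω).hom := by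
  rw [← Over.w p, ← Category.assoc, h]
  exact Over.w x

/-- The `Ω`-point of `T` defined by a morphism of schemes `t : Spec Ω ⟶ T` over `x` maps to `x`.
[cite: GortzWedhorn2020, Section (4.7), (4.7.1) (p. 108)] -/
theorem map_homMk_eq {t : Spec (.of Ω) ⟶ T.left} (h : t ≫ p.left = x.left) :
    AlgPoints.map p (Over.homMk t (comp_hom_eq_of_comp_left_eq p x h) : AlgPoints T Ω) = x := by
  apply Over.OverMorphism.ext
  rw [AlgPoints.map_apply, Over.comp_left]
  exact h

/-- **The `Ω`-points of `T` over `x ∈ X(Ω)` are the morphisms of schemes `Spec Ω ⟶ T` over `x`**: `y ↦ y.left` is a bijection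
`{y : AlgPoints T Ω // AlgPoints.map p y = x} ≃ {t : Spec Ω ⟶ T // t ≫ p = x}` (an `Over`-morphism is determined by its underlying morphism,
Mathlib `Over.OverMorphism.ext`). Stated as `Function.Bijective` to stay definition-free. [cite: GortzWedhorn2020, Section (4.7), (4.7.1) (p. 108)] -/
theorem bijective_left_fibre :
    Function.Bijective (fun y : {y : AlgPoints T Ω // AlgPoints.map p y = x} =>
      (⟨y.1.left, left_comp_left_of_map_eq p x y.2⟩ : {t : Spec (.of Ω) ⟶ T.left // t ≫ p.left = x.left})) := by
  refine ⟨fun y y' h => ?_, fun t => ?_⟩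
  · exact Subtype.ext (Over.OverMorphism.ext (congrArg Subtype.val h))
  · exact ⟨⟨Over.homMk t.1 (comp_hom_eq_of_comp_left_eq p x t.2), map_homMk_eq p x t.2⟩, rfl⟩

/-- The cardinality form of `bijective_left_fibre`. [cite: GortzWedhorn2020, Section (4.7), (4.7.1) (p. 108)] -/
theorem natCard_fibre_eq_natCard_specOver :
    Nat.card {y : AlgPoints T Ω // AlgPoints.map p y = x} = Nat.card {t : Spec (.of Ω) ⟶ T.left // t ≫ p.left = x.left} :=
  Nat.card_eq_of_bijective _ (bijective_left_fibre p x)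

/-- **(Γ3-D) A finite étale morphism has exactly `rank` geometric points in every geometric fibre** — `AlgPoints` form: for `p : T ⟶ X`
over `k` with `p.left` finite étale, `Ω ⊇ k` separably closed and `x ∈ X(Ω)`,
`Nat.card {y : AlgPoints T Ω // AlgPoints.map p y = x} = p.left.finrank (x.toSpecHom.base (closedPoint Ω))` (Mathlib's degree function
`Scheme.Hom.finrank` at the image point of `x`; ★ `Morphisms.natCard_specOver_eq_finrank` transported along `bijective_left_fibre`).
[cite: GortzWedhorn2020, Prop. 12.21] [cite: StacksProject, Tag 02GL] -/
theorem card_fibre_eq_finrank_of_isFinite_of_etale [IsSepClosed Ω] [IsFinite p.left] [Etale p.left] :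
    Nat.card {y : AlgPoints T Ω // AlgPoints.map p y = x} = p.left.finrank (x.toSpecHom.base (IsLocalRing.closedPoint Ω)) := by
  rw [natCard_fibre_eq_natCard_specOver p x]
  exact Literature.AlgebraicGeometry.Morphisms.natCard_specOver_eq_finrank p.left x.left

/-- Finiteness: a finite étale `p` has finitely many geometric points over every geometric point. [cite: GortzWedhorn2020, Prop. 12.21] -/
theorem finite_fibre_of_isFinite_of_etale [IsSepClosed Ω] [IsFinite p.left] [Etale p.left] :
    Finite {y : AlgPoints T Ω // AlgPoints.map p y = x} := by
  haveI := Literature.AlgebraicGeometry.Morphisms.finite_specOver p.left x.left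
  exact Finite.of_injective _ (bijective_left_fibre p x).1

/-- Over a PRECONNECTED `X` the number of geometric points of a finite étale `p` over `x ∈ X(Ω)` is the (constant) degree `p.left.finrank b`
at ANY point `b` of `X` (Mathlib `Scheme.Hom.isLocallyConstant_finrank`). [cite: GortzWedhorn2020, (12.6.1)] [cite: GortzWedhorn2020, Prop. 12.21] -/
theorem card_fibre_eq_finrank_of_preconnectedSpace [IsSepClosed Ω] [IsFinite p.left] [Etale p.left] [PreconnectedSpace X.left]
    (b : X.left) : Nat.card {y : AlgPoints T Ω // AlgPoints.map p y = x} = p.left.finrank b := by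
  rw [natCard_fibre_eq_natCard_specOver p x]
  exact Literature.AlgebraicGeometry.Morphisms.natCard_specOver_eq_finrank_of_preconnectedSpace p.left x.left b

/-- Hence over a preconnected `X` any two geometric fibres of a finite étale `p` (possibly over different separably closed fields `Ω`, `Ω'`)
have the same number of points. [cite: GortzWedhorn2020, (12.6.1)] -/
theorem card_fibre_eq_card_fibre_of_preconnectedSpace [IsSepClosed Ω] [IsFinite p.left] [Etale p.left] [PreconnectedSpace X.left]
    {Ω' : Type u} [Field Ω'] [Algebra k Ω'] [IsSepClosed Ω'] (x' : AlgPoints X Ω') :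
    Nat.card {y : AlgPoints T Ω // AlgPoints.map p y = x} = Nat.card {y' : AlgPoints T Ω' // AlgPoints.map p y' = x'} := by
  rw [natCard_fibre_eq_natCard_specOver p x, natCard_fibre_eq_natCard_specOver p x']
  exact Literature.AlgebraicGeometry.Morphisms.natCard_specOver_eq_of_preconnectedSpace p.left x.left x'.left

end AlgPoints

end Literature.AlgebraicGeometry.Motives

end
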